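import Literature.Computability.AlgebraicComplexity.SmallFormatRankNormalization
import HarnessLib

/-!
# Constrained matrix multiplication: monotonicity and sandwich invariance (Wang 2026, Lemma 1)

Topic `Literature/Computability/AlgebraicComplexity`. PROVED, no named facts.

Wang 2026 bounds `R(⟨c,m,n⟩)` from below through the tensors `T_S` obtained by constraining
the first argument `X ∈ k^{c×m}` to a subspace `S` (§3.2); the dynamic programme "needs only one
representative per orbit" of `S` under the sandwich symmetries `X ↦ P X Q` (§3.3, §4.1) because
of **Lemma 1**: (monotonicity) imposing further constraints cannot raise the rank, and (orbit
invariance) `R(T_S) = R(T_{g(S)})` for a rank-preserving first-argument symmetry `g`.  In the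
language of bilinear computations (Bläser 2003, Def. 1;
`BilinComp (mulBilin k c m n ∘ S.subtype)`) both are one transport (`BilinComp.comap`,
Bläser 2003 §3): if `P S Q ⊆ S'` for invertible `P, Q`, every computation of `(X, Y) ↦ XY`
on `S' × k^{m×n}` yields one of the same length on `S × k^{m×n}`, via
`XY = P⁻¹ ((P X Q)(Q⁻¹ Y))`.

* `BilinComp.ofSandwichLE` — the transport; `exists_bilinComp_constrained_of_sandwich` — the
  length statement; `BilinComp.ofLE` — plain monotonicity (`P = Q = 1`).

A certificate checker uses this with an explicit witness `(P, Q)` and the finitely many membership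
checks `P x_j Q ∈ S'` for a basis `x_j` of `S` (no canonical forms needed).

## References

* C. Wang, *Automated Lower Bounds for Bilinear Complexity over Finite Fields*, arXiv:2603.07280
  (2026), §3.2–§3.3 (Lemma 1), §4.1. [Wang2026]
* M. Bläser, J. Complexity 19 (2003) 43–60, §3 (equivalent computations). [Blaser2003]
-/

namespace Literature.Computability.AlgebraicComplexity

open Module Matrix

variable {k : Type*} [Field k] {c m n : ℕ} {ι : Type*} [Fintype ι]

namespace BilinComp

/-- **Transport along a sandwich** (Wang 2026, Lemma 1; Bläser 2003, §3): if `P x Q ∈ S'` for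
all `x ∈ S`, with `P' P = 1` and `Q Q' = 1`, a computation of `(x, y) ↦ x y` on `S' × k^{m×n}`
gives one on `S × k^{m×n}` with the same index set: `f̃_i(x) = f_i(P x Q)`,
`g̃_i(y) = g_i(Q' y)`, `w̃_i = P' w_i` (`x y = P'((P x Q)(Q' y))`). [cite: Wang2026, Lemma 1] -/
noncomputable def ofSandwichLE {S S' : Submodule k (Matrix (Fin c) (Fin m) k)}
    (P P' : Matrix (Fin c) (Fin c) k) (Q Q' : Matrix (Fin m) (Fin m) k) (hP : P' * P = 1)
    (hQ : Q * Q' = 1) (hmap : ∀ x ∈ S, P * x * Q ∈ S')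
    (β : BilinComp ((mulBilin k c m n).comp S'.subtype) ι) :
    BilinComp ((mulBilin k c m n).comp S.subtype) ι :=
  β.comap
    (LinearMap.codRestrict S' (((mulLeftLin k P).comp (mulRightLin k Q)).comp S.subtype)
      (fun x => by simpa [Matrix.mul_assoc] using hmap x x.2))
    (mulLeftLin k Q') (mulLeftLin k P')
    (fun x y => by
      simp only [LinearMap.comp_apply, Submodule.subtype_apply, mulBilin_apply,
        LinearMap.codRestrict_apply, mulLeftLin_apply, mulRightLin_apply]
      rw [Matrix.mul_assoc P, Matrix.mul_assoc (x : Matrix (Fin c) (Fin m) k) Q,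
        ← Matrix.mul_assoc Q Q' y, hQ, Matrix.one_mul, ← Matrix.mul_assoc P' P, hP,
        Matrix.one_mul])

/-- The first forms of the transported computation. [cite: Wang2026, Lemma 1] -/
@[simp] theorem ofSandwichLE_f {S S' : Submodule k (Matrix (Fin c) (Fin m) k)}
    (P P' : Matrix (Fin c) (Fin c) k) (Q Q' : Matrix (Fin m) (Fin m) k) (hP : P' * P = 1)
    (hQ : Q * Q' = 1) (hmap : ∀ x ∈ S, P * x * Q ∈ S')
    (β : BilinComp ((mulBilin k c m n).comp S'.subtype) ι) (i : ι) (x : S) :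
    (β.ofSandwichLE P P' Q Q' hP hQ hmap).f i x
      = β.f i ⟨P * (x : Matrix (Fin c) (Fin m) k) * Q, hmap x x.2⟩ := by
  simp only [ofSandwichLE, comap, LinearMap.comp_apply]
  congr 1
  apply Subtype.ext
  simp [Matrix.mul_assoc]

/-- **Monotonicity** (Wang 2026, Lemma 1, first part): a computation on the larger subspace
`S' ⊇ S` restricts to one on `S` with the same index set. [cite: Wang2026, Lemma 1] -/
noncomputable def ofLE {S S' : Submodule k (Matrix (Fin c) (Fin m) k)} (h : S ≤ S')
    (β : BilinComp ((mulBilin k c m n).comp S'.subtype) ι) :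
    BilinComp ((mulBilin k c m n).comp S.subtype) ι :=
  β.ofSandwichLE 1 1 1 1 (Matrix.one_mul 1) (Matrix.one_mul 1)
    (fun x hx => by simpa using h hx)

end BilinComp

/-- **Wang 2026, Lemma 1, as a length statement**: if `P S Q ⊆ S'` for invertible `P, Q`, and
`XY` restricted to `S'` has a computation of length `r`, then so has `XY` restricted to `S`; in
particular sandwich-equivalent constraint subspaces have the same minimal length, and a
smaller subspace never needs more products. [cite: Wang2026, Lemma 1] -/
theorem exists_bilinComp_constrained_of_sandwich {S S' : Submodule k (Matrix (Fin c) (Fin m) k)}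
    (P P' : Matrix (Fin c) (Fin c) k) (Q Q' : Matrix (Fin m) (Fin m) k) (hP : P' * P = 1)
    (hQ : Q * Q' = 1) (hmap : ∀ x ∈ S, P * x * Q ∈ S') {r : ℕ}
    (h : Nonempty (BilinComp ((mulBilin k c m n).comp S'.subtype) (Fin r))) :
    Nonempty (BilinComp ((mulBilin k c m n).comp S.subtype) (Fin r)) :=
  ⟨h.some.ofSandwichLE P P' Q Q' hP hQ hmap⟩

/-! ## From constrained computations to the rank of `⟨c,m,n⟩` -/

section Bridge

variable {U' V' W' : Type*} [AddCommGroup U'] [Module k U'] [AddCommGroup V'] [Module k V']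
  [AddCommGroup W'] [Module k W'] {φ : U' →ₗ[k] V' →ₗ[k] W'}

/-- Restricting the first argument of any computation to a subspace (Wang 2026, Lemma 1,
monotonicity, at the top: "substituting that subspace into `T` yields a smaller tensor `T_S`
with `R(T) ≥ R(T_S)`"). [cite: Wang2026, Lemma 1] -/
def BilinComp.restrictSub (β : BilinComp φ ι) (S : Submodule k U') :
    BilinComp (φ.comp S.subtype) ι :=
  β.comap S.subtype LinearMap.id LinearMap.id (fun x y => by simp)

end Bridge

/-- **The bridge to `R(⟨c,m,n⟩)`** (Wang 2026, §3.2 with Lemma 1: `R(T) ≥ R(T_S)` for every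
constraint subspace `S`; at `S = ⊤` this is "the unconstrained orbit's bound is *the* bound for the
problem", §7): if every computation of `XY` on `S × k^{m×n}` has at least `b` products, then
`b ≤ R(⟨c,m,n⟩)`. [cite: Wang2026, Lemma 1 and §7] -/
theorem le_tensorRank_matMulTensor_of_forall_constrained {b : ℕ}
    (S : Submodule k (Matrix (Fin c) (Fin m) k))
    (h : ∀ r, BilinComp ((mulBilin k c m n).comp S.subtype) (Fin r) → b ≤ r) :
    b ≤ tensorRank (matMulTensor k c m n) := by
  obtain ⟨β⟩ := exists_bilinComp_of_tensorRank_le (k := k) (c := c) (m := m) (n := n) le_rfl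
  exact h _ (β.restrictSub S)

end Literature.Computability.AlgebraicComplexity
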